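import Literature.AlgebraicGeometry.Resolution.KollarFunctorLinearCentre
import Literature.AlgebraicGeometry.Resolution.EtaleNhdOfFlatUnramifiedPoint
import Literature.AlgebraicGeometry.Resolution.AffineDomainEquidim
import Literature.RingTheory.Flat.RegularFibreFlat
import Mathlib.RingTheory.Unramified.LocalRing
import Mathlib.RingTheory.LocalRing.ResidueField.Ideal
import Mathlib.RingTheory.Jacobson.Ring
import Mathlib.FieldTheory.Perfect
import HarnessLib

/-!
# Étale charts of `𝔸ⁿ` adapted to a regular closed subscheme at a closed point

Topic: `Literature/AlgebraicGeometry/Resolution`. The local structure of a closed subscheme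
`Z = V(P) ⊆ 𝔸ⁿ_K` (`K` of characteristic zero) at a closed point `z ∈ Z` at which `Z` is
regular: on a basic open `D(G) ∋ z` there is an ÉTALE `K`-morphism `φ : D(G) → 𝔸ⁿ_K` with
`𝓘_Z|_{D(G)} = φ^* 𝓘_L` for a coordinate subspace `L = V(yᵢ : i ∈ s)`. This is the input that
transports the value of a functorial resolution on the linear model (`KollarFunctorLinearCentre`,
Kollár 2007, 3.34.1) to `(U, 𝓘_Z, 1, ∅)`, `Z ⊆ U ⊆ 𝔸ⁿ_K` smooth — BGMW 2011, proof of Thm. 4.0.6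
for `𝓘 = 𝓘_Z` ("the blow-up of `X` [along `Z`] … defines a unique resolution"). All PROVED:

* `exists_coordinates_of_isRegularLocalRing_quotient` — at a closed point `𝔪 ⊇ P` of
  `K[x₁, …, xₙ]` with `(K[x]_𝔪)/P` regular there are `u₁, …, uₙ ∈ 𝔪` generating `𝔪 K[x]_𝔪` with
  `P K[x]_𝔪 = (uᵢ : i ∈ s) K[x]_𝔪`, `uᵢ ∈ P` for `i ∈ s` (Matsumura Thm. 14.2, tree
  `exists_rsop_of_isRegularLocalRing_quotient`; `emb dim K[x]_𝔪 = n`);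
* `exists_not_mem_forall_map_eq` — two finitely generated ideals that agree in `R_𝔪` agree in
  every `R`-algebra in which some `g ∉ 𝔪` is invertible;
* `localRingHom_flat_and_formallyUnramified` — for `Φ : K[y] → K[x]` (`K`-algebras of
  polynomials, `#y ≤ #x`) and a maximal `𝔪 ⊆ K[x]` with `Φ(yᵢ) ∈ 𝔪` generating `𝔪 K[x]_𝔪`, the
  local homomorphism `K[y]_𝔫 → K[x]_𝔪` (`𝔫 = Φ⁻¹𝔪`) is FLAT (Matsumura Thm. 23.1 in the
  regular-fibre form, tree `Literature.RingTheory.Flat.flat_of_isRegularLocalRing_of_isRegularLocalRing_fiber`: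
  `dim K[y]_𝔫 + dim (fibre) ≤ ht 𝔫 + 0 ≤ n = dim K[x]_𝔪`) and UNRAMIFIED (`𝔫 ↦ 𝔪 K[x]_𝔪`,
  residue fields separable in characteristic zero; Mathlib
  `Algebra.FormallyUnramified.of_map_maximalIdeal`);
* `exists_etale_chart_of_isRegularLocalRing_quotient` — **the chart**: `G ∉ 𝔪`, `s ≠ ∅`,
  `Φ : K[x] → K[x]` with `D(G)` inside a prescribed neighbourhood, `D(G) → 𝔸ⁿ --Spec Φ--> 𝔸ⁿ` étale
  (EGA IV₄ 17.6.1, tree `exists_etale_ι_comp_of_flat_of_formallyUnramified_stalkMap`) and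
  `P̃|_{D(G)} = (Spec Φ)^*(yᵢ : i ∈ s)~|_{D(G)}`.

## Sources

* E. Bierstone, D. Grigoriev, P. Milman, J. Włodarczyk, *Effective Hironaka resolution and its
  complexity*, Asian J. Math. 15 (2011), §3.5 (local coordinates on smooth varieties) and the
  proof of Thm. 4.0.6 (arXiv:1206.3090, pp. 7, 11–13). [BierstoneGrigorievMilmanWlodarczyk2011]
* H. Matsumura, *Commutative Ring Theory* (1986), Thm. 14.2, Thm. 23.1. [Matsumura1987]
* A. Grothendieck, J. Dieudonné, EGA IV₄ (1967), Thm. 17.6.1. [Grothendieck1967]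
-/

noncomputable section

open CategoryTheory CategoryTheory.Limits AlgebraicGeometry TopologicalSpace IsLocalRing

namespace Literature.AlgebraicGeometry.Resolution

universe u

/-! ## Coordinates at a closed point adapted to a regular subscheme -/

section Coordinates

open _root_.MvPolynomial

variable {K : Type u} [Field K] {n : ℕ}

/-- **Adapted coordinates at a regular point** (Matsumura Thm. 14.2 at a closed point of `𝔸ⁿ`).
Let `𝔪 ⊇ P` be a maximal ideal of `K[x₁, …, xₙ]` such that `K[x]_𝔪 / P K[x]_𝔪` is a regular local
ring. Then there are `u₁, …, uₙ ∈ 𝔪` and `s ⊆ {1, …, n}` with `uᵢ ∈ P` for `i ∈ s`, the `uᵢ`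
generating `𝔪 K[x]_𝔪`, and `P K[x]_𝔪 = (uᵢ : i ∈ s) K[x]_𝔪` (a minimal basis of the maximal
ideal of the `n`-dimensional regular local ring `K[x]_𝔪` containing generators of `P K[x]_𝔪`,
with numerators in `K[x]`). [cite: Matsumura1987, Thm. 14.2] -/
theorem exists_coordinates_of_isRegularLocalRing_quotient (𝔪 : Ideal (MvPolynomial (Fin n) K))
    [𝔪.IsMaximal] (P : Ideal (MvPolynomial (Fin n) K)) (hPm : P ≤ 𝔪)
    (hreg : IsRegularLocalRing (Localization.AtPrime 𝔪 ⧸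
      P.map (algebraMap (MvPolynomial (Fin n) K) (Localization.AtPrime 𝔪)))) :
    ∃ (u : Fin n → MvPolynomial (Fin n) K) (s : Set (Fin n)),
      (∀ i, u i ∈ 𝔪) ∧ (∀ i ∈ s, u i ∈ P) ∧
      Ideal.span (Set.range fun i => algebraMap _ (Localization.AtPrime 𝔪) (u i)) =
        maximalIdeal (Localization.AtPrime 𝔪) ∧
      P.map (algebraMap _ (Localization.AtPrime 𝔪)) =
        Ideal.span ((fun i => algebraMap _ (Localization.AtPrime 𝔪) (u i)) '' s) := by
  classical
  set B := Localization.AtPrime 𝔪 with hB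
  set J : Ideal B := P.map (algebraMap _ B) with hJ
  have hJle : J ≤ maximalIdeal B := by
    rw [← Localization.AtPrime.map_eq_maximalIdeal]
    exact Ideal.map_mono hPm
  haveI : IsRegularLocalRing (B ⧸ J) := hreg
  haveI : IsRegularLocalRing B := inferInstance
  obtain ⟨u', hu', S', hS'⟩ := exists_rsop_of_isRegularLocalRing_quotient hJle
  -- `emb dim K[x]_𝔪 = n`
  have hd : (maximalIdeal B).spanFinrank = n := by
    have h1 : ((maximalIdeal B).spanFinrank : WithBot ℕ∞) = ringKrullDim B :=
      IsRegularLocalRing.spanFinrank_maximalIdeal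
    have h2 : ringKrullDim B = n := by
      show ringKrullDim (Localization.AtPrime 𝔪) = n
      rw [ringKrullDim_localization_atPrime_eq_of_isMaximal K 𝔪,
        MvPolynomial.ringKrullDim_of_isNoetherianRing, ringKrullDim_eq_zero_of_field]
      simp
    rw [h2] at h1
    exact_mod_cast h1
  let e : Fin n ≃ Fin (maximalIdeal B).spanFinrank := finCongr hd.symm
  -- numerators in `K[x]`
  have hnum : ∀ i : Fin n, ∃ a : MvPolynomial (Fin n) K, a ∈ 𝔪 ∧ (e i ∈ S' → a ∈ P) ∧
      ∃ t : 𝔪.primeCompl, algebraMap _ B a = u' (e i) * algebraMap _ B (t : MvPolynomial (Fin n) K) := by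
    intro i
    by_cases hi : e i ∈ S'
    · have hmem : u' (e i) ∈ J := hS'.symm.le (Ideal.subset_span ⟨e i, hi, rfl⟩)
      obtain ⟨⟨⟨a, ha⟩, t⟩, hat⟩ := (IsLocalization.mem_map_algebraMap_iff 𝔪.primeCompl B).mp hmem
      exact ⟨a, hPm ha, fun _ => ha, t, hat.symm⟩
    · have hmem : u' (e i) ∈ 𝔪.map (algebraMap _ B) := by
        rw [Localization.AtPrime.map_eq_maximalIdeal]
        exact hu'.le (Ideal.subset_span ⟨e i, rfl⟩)
      obtain ⟨⟨⟨a, ha⟩, t⟩, hat⟩ := (IsLocalization.mem_map_algebraMap_iff 𝔪.primeCompl B).mp hmem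
      exact ⟨a, ha, fun h => absurd h hi, t, hat.symm⟩
  choose u hu𝔪 huP t hut using hnum
  have hunit : ∀ i, IsUnit (algebraMap _ B (t i : MvPolynomial (Fin n) K)) := fun i =>
    IsLocalization.map_units B (t i)
  -- `u' (e i)` is a unit multiple of `algebraMap (u i)`
  have hu'eq : ∀ i, u' (e i) = algebraMap _ B (u i) * ↑((hunit i).unit⁻¹) := fun i => by
    rw [hut i, mul_assoc, IsUnit.mul_val_inv, mul_one]
  refine ⟨u, e ⁻¹' S', hu𝔪, fun i hi => huP i hi, ?_, ?_⟩
  · rw [← hu']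
    apply le_antisymm
    · rw [Ideal.span_le]
      rintro _ ⟨i, rfl⟩
      show algebraMap _ B (u i) ∈ Ideal.span (Set.range u')
      rw [hut i]
      exact Ideal.mul_mem_right _ _ (Ideal.subset_span ⟨e i, rfl⟩)
    · rw [Ideal.span_le]
      rintro _ ⟨k, rfl⟩
      show u' k ∈ _
      rw [show k = e (e.symm k) from (e.apply_symm_apply k).symm, hu'eq]
      exact Ideal.mul_mem_right _ _ (Ideal.subset_span ⟨e.symm k, rfl⟩)
  · rw [hS']
    apply le_antisymm
    · rw [Ideal.span_le]
      rintro _ ⟨k, hk, rfl⟩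
      show u' k ∈ _
      rw [show k = e (e.symm k) from (e.apply_symm_apply k).symm, hu'eq]
      refine Ideal.mul_mem_right _ _ (Ideal.subset_span ⟨e.symm k, ?_, rfl⟩)
      change e (e.symm k) ∈ S'
      rwa [e.apply_symm_apply]
    · rw [Ideal.span_le]
      rintro _ ⟨i, hi, rfl⟩
      show algebraMap _ B (u i) ∈ _
      rw [hut i]
      exact Ideal.mul_mem_right _ _ (Ideal.subset_span ⟨e i, hi, rfl⟩)

/-- **Two finitely generated ideals `Q ⊆ P` that agree in `R_𝔪` agree wherever some `g ∉ 𝔪` is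
invertible** (in particular on the basic open `D(g)`): clear the finitely many denominators.
[folklore] -/
theorem exists_not_mem_forall_map_eq {R : Type u} [CommRing R] [IsNoetherianRing R]
    (𝔪 : Ideal R) [𝔪.IsPrime] {P Q : Ideal R} (hQP : Q ≤ P)
    (h : P.map (algebraMap R (Localization.AtPrime 𝔪)) ≤
      Q.map (algebraMap R (Localization.AtPrime 𝔪))) :
    ∃ g : R, g ∉ 𝔪 ∧ ∀ (A : Type u) [CommRing A] [Algebra R A], IsUnit (algebraMap R A g) →
      P.map (algebraMap R A) = Q.map (algebraMap R A) := by
  classical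
  obtain ⟨G, hG⟩ := (inferInstance : IsNoetherian R R).noetherian P
  have hgen : ∀ q ∈ G, ∃ t : R, t ∉ 𝔪 ∧ t * q ∈ Q := by
    intro q hq
    have hqP : q ∈ P := hG ▸ Submodule.subset_span hq
    have hmem : algebraMap R (Localization.AtPrime 𝔪) q ∈ Q.map (algebraMap R _) :=
      h (Ideal.mem_map_of_mem _ hqP)
    obtain ⟨⟨⟨x, hx⟩, c⟩, hxc⟩ :=
      (IsLocalization.mem_map_algebraMap_iff 𝔪.primeCompl (Localization.AtPrime 𝔪)).mp hmem
    -- `q * c = x` in `R_𝔪`, hence `d * (q * c) = d * x` in `R` for some `d ∉ 𝔪`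
    have hxc' : algebraMap R (Localization.AtPrime 𝔪) (q * c) = algebraMap R _ x := by
      rw [map_mul]
      exact hxc
    obtain ⟨d, hd⟩ := (IsLocalization.eq_iff_exists 𝔪.primeCompl (Localization.AtPrime 𝔪)).mp hxc'
    refine ⟨d * c, ?_, ?_⟩
    · exact (𝔪.primeCompl.mul_mem d.2 c.2 :)
    · have : ↑d * ↑c * q = ↑d * x := by rw [mul_assoc, mul_comm (c : R) q]; exact hd
      rw [this]
      exact Q.mul_mem_left _ hx
  choose! t ht htq using hgen
  refine ⟨∏ q ∈ G, t q, ?_, fun A _ _ hunit => ?_⟩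
  · exact (Submonoid.prod_mem 𝔪.primeCompl fun q hq => (ht q hq : t q ∈ 𝔪.primeCompl) :)
  · apply le_antisymm
    · rw [← hG, Ideal.map_span, Ideal.span_le]
      rintro _ ⟨q, hq, rfl⟩
      have htu : IsUnit (algebraMap R A (t q)) := by
        refine isUnit_of_dvd_unit ?_ hunit
        exact map_dvd _ (Finset.dvd_prod_of_mem t hq)
      have : algebraMap R A q = ↑(htu.unit⁻¹) * algebraMap R A (t q * q) := by
        rw [map_mul, ← mul_assoc, IsUnit.val_inv_mul, one_mul]
      rw [SetLike.mem_coe, this]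
      exact Ideal.mul_mem_left _ _ (Ideal.mem_map_of_mem _ (htq q hq))
    · exact Ideal.map_mono hQP

end Coordinates

/-! ## The local homomorphism `K[y]_𝔫 → K[x]_𝔪` is flat and unramified -/

section LocalHom

open _root_.MvPolynomial

variable {K : Type u} [Field K]

/-- **Flat and unramified at the centre.** Let `K` have characteristic zero, `Φ : K[y] → K[x]` a
`K`-algebra homomorphism of polynomial rings with `#y ≤ #x`, and `𝔪 ⊆ K[x]` a maximal ideal with
`Φ(yᵢ) ∈ 𝔪` for all `i` and `𝔪 K[x]_𝔪 ⊆ (Φ(yᵢ))`. Then the local homomorphism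
`K[y]_𝔫 → K[x]_𝔪`, `𝔫 = Φ⁻¹(𝔪)`, is flat and formally unramified: the fibre
`K[x]_𝔪 / 𝔫 K[x]_𝔪 = κ(𝔪)` is a field, so flatness is Matsumura's Thm. 23.1 for the regular local
rings `K[y]_𝔫` (`dim = ht 𝔫 ≤ #y`) and `K[x]_𝔪` (`dim = #x`), and unramifiedness is
`𝔫 K[x]_𝔪 = 𝔪 K[x]_𝔪` with `κ(𝔪)/κ(𝔫)` separable (characteristic zero).
[cite: Matsumura1987, Thm. 23.1] [cite: Grothendieck1967, Thm. 17.6.1] -/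
theorem localRingHom_flat_and_formallyUnramified [CharZero K] {ι ι' : Type} [Finite ι]
    [Finite ι'] (hcard : Nat.card ι ≤ Nat.card ι')
    (Φ : MvPolynomial ι K →ₐ[K] MvPolynomial ι' K) (𝔪 : Ideal (MvPolynomial ι' K)) [𝔪.IsMaximal]
    (hX𝔪 : ∀ i, Φ (X i) ∈ 𝔪)
    (hgen : maximalIdeal (Localization.AtPrime 𝔪) ≤
      Ideal.span (Set.range fun i => algebraMap _ (Localization.AtPrime 𝔪) (Φ (X i)))) :
    (Localization.localRingHom (𝔪.comap (Φ : MvPolynomial ι K →+* MvPolynomial ι' K)) 𝔪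
        (Φ : MvPolynomial ι K →+* MvPolynomial ι' K) rfl).Flat ∧
      (Localization.localRingHom (𝔪.comap (Φ : MvPolynomial ι K →+* MvPolynomial ι' K)) 𝔪
        (Φ : MvPolynomial ι K →+* MvPolynomial ι' K) rfl).FormallyUnramified := by
  set R₁ := MvPolynomial ι K
  set R₂ := MvPolynomial ι' K
  set 𝔫 : Ideal R₁ := 𝔪.comap (Φ : R₁ →+* R₂) with h𝔫
  set A := Localization.AtPrime 𝔫
  set B := Localization.AtPrime 𝔪
  set f : A →+* B := Localization.localRingHom 𝔫 𝔪 (Φ : R₁ →+* R₂) rfl with hfdef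
  letI : Algebra A B := f.toAlgebra
  have hf : algebraMap A B = f := rfl
  haveI : IsLocalHom (algebraMap A B) := by
    rw [hf, hfdef]
    infer_instance
  -- the `K`-structures are compatible
  haveI : IsScalarTower K A B := by
    refine IsScalarTower.of_algebraMap_eq fun c => ?_
    rw [hf, IsScalarTower.algebraMap_apply K R₁ A c, hfdef, Localization.localRingHom_to_map,
      IsScalarTower.algebraMap_apply K R₂ B c]
    congr 1
    rw [MvPolynomial.algebraMap_eq, MvPolynomial.algebraMap_eq]
    exact (Φ.commutes c).symm
  -- `𝔫 K[x]_𝔪 = 𝔪 K[x]_𝔪`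
  have hmax : (maximalIdeal A).map (algebraMap A B) = maximalIdeal B := by
    apply le_antisymm
    · exact ((local_hom_TFAE (algebraMap A B)).out 0 2 rfl rfl).mp ‹_›
    · refine hgen.trans ?_
      rw [Ideal.span_le]
      rintro _ ⟨i, rfl⟩
      have h1 : algebraMap R₁ A (X i) ∈ maximalIdeal A := by
        rw [← Localization.AtPrime.map_eq_maximalIdeal]
        exact Ideal.mem_map_of_mem _ (Ideal.mem_comap.mpr (hX𝔪 i))
      have h2 : algebraMap A B (algebraMap R₁ A (X i)) = algebraMap R₂ B (Φ (X i)) := by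
        rw [hf, hfdef, Localization.localRingHom_to_map]
        rfl
      show algebraMap R₂ B (Φ (X i)) ∈ _
      rw [← h2]
      exact Ideal.mem_map_of_mem _ h1
  -- (i) unramified
  have hur : Algebra.FormallyUnramified A B := by
    haveI : Algebra.EssFiniteType K B :=
      Algebra.EssFiniteType.comp K R₂ B
    haveI : Algebra.EssFiniteType A B := Algebra.EssFiniteType.of_comp K A B
    haveI : CharZero (ResidueField A) :=
      charZero_of_injective_algebraMap (algebraMap K (ResidueField A)).injective
    -- `κ(𝔪)` is algebraic over `K` (Nullstellensatz), hence over `κ(𝔫)`, hence separable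
    haveI : Algebra.IsAlgebraic K (ResidueField B) := by
      have hint : ((algebraMap R₂ (ResidueField B)).comp C).IsIntegral :=
        MvPolynomial.comp_C_integral_of_surjective_of_isJacobsonRing _
          (Ideal.algebraMap_residueField_surjective 𝔪)
      have heq : (algebraMap R₂ (ResidueField B)).comp C = algebraMap K (ResidueField B) := by
        rw [← MvPolynomial.algebraMap_eq, ← IsScalarTower.algebraMap_eq]
      rw [heq] at hint
      haveI : Algebra.IsIntegral K (ResidueField B) := ⟨fun x => hint x⟩
      infer_instance
    haveI : Algebra.IsAlgebraic (ResidueField A) (ResidueField B) :=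
      Algebra.IsAlgebraic.tower_top (K := K) _
    exact Algebra.FormallyUnramified.of_map_maximalIdeal hmax
  -- (ii) flat (Matsumura 23.1, regular fibre of dimension `0`)
  have hfl : Module.Flat A B := by
    have hF : IsRegularLocalRing (B ⧸ (maximalIdeal A).map (algebraMap A B)) := by
      rw [hmax]
      letI := Ideal.Quotient.field (maximalIdeal B)
      infer_instance
    have hdim : ringKrullDim A + ringKrullDim (B ⧸ (maximalIdeal A).map (algebraMap A B)) ≤
        ringKrullDim B := by
      rw [hmax]
      have h0 : ringKrullDim (B ⧸ maximalIdeal B) = 0 := by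
        letI := Ideal.Quotient.field (maximalIdeal B)
        exact ringKrullDim_eq_zero_of_field _
      have hA : ringKrullDim A ≤ Nat.card ι := by
        rw [IsLocalization.AtPrime.ringKrullDim_eq_height 𝔫 A]
        have := Ideal.height_le_ringKrullDim_of_isPrime (I := 𝔫)
        rwa [MvPolynomial.ringKrullDim_of_isNoetherianRing, ringKrullDim_eq_zero_of_field,
          zero_add] at this
      have hBd : ringKrullDim B = Nat.card ι' := by
        rw [ringKrullDim_localization_atPrime_eq_of_isMaximal K 𝔪,
          MvPolynomial.ringKrullDim_of_isNoetherianRing, ringKrullDim_eq_zero_of_field, zero_add]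
      rw [h0, add_zero, hBd]
      exact hA.trans (by exact_mod_cast hcard)
    exact Literature.RingTheory.Flat.flat_of_isRegularLocalRing_of_isRegularLocalRing_fiber hF hdim
  exact ⟨hfl, hur⟩

end LocalHom

/-! ## The étale chart -/

section Chart

open _root_.MvPolynomial

variable {K : Type u} [Field K] {n : ℕ}

/-- `Spec Φ : 𝔸ⁿ → 𝔸ᵐ` is locally of finite presentation for every `K`-algebra map
`Φ : K[y] → K[x]`. [folklore] -/
theorem locallyOfFinitePresentation_specMap_algHom {ι ι' : Type} [Finite ι] [Finite ι']
    (Φ : MvPolynomial ι K →ₐ[K] MvPolynomial ι' K) :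
    LocallyOfFinitePresentation
      (Spec.map (CommRingCat.ofHom (Φ : MvPolynomial ι K →+* MvPolynomial ι' K))) := by
  rw [HasRingHomProperty.Spec_iff (P := @LocallyOfFinitePresentation)]
  letI : Algebra (MvPolynomial ι K) (MvPolynomial ι' K) :=
    (Φ : MvPolynomial ι K →+* MvPolynomial ι' K).toAlgebra
  haveI : IsScalarTower K (MvPolynomial ι K) (MvPolynomial ι' K) :=
    IsScalarTower.of_algebraMap_eq fun c => by
      change algebraMap K (MvPolynomial ι' K) c = Φ (algebraMap K (MvPolynomial ι K) c)
      exact (Φ.commutes c).symm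
  have : Algebra.FinitePresentation (MvPolynomial ι K) (MvPolynomial ι' K) :=
    Algebra.FinitePresentation.of_restrict_scalars_finitePresentation K _ _
  exact this

/-- The basic open `D(G) = Spec K[x]_G → 𝔸ⁿ` has range `D(G)`. [folklore] -/
theorem range_specMap_algebraMap_away {R : Type u} [CommRing R] (G : R) :
    Set.range (Spec.map (CommRingCat.ofHom (algebraMap R (Localization.Away G)))) =
      (PrimeSpectrum.basicOpen G : Set (PrimeSpectrum R)) := by
  change Set.range (PrimeSpectrum.comap (algebraMap R (Localization.Away G))) = _
  exact PrimeSpectrum.localization_away_comap_range (Localization.Away G) G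

/-- **Étale chart adapted to a regular closed subscheme at a closed point.** Let `K` have
characteristic zero, `0 ≠ P ⊆ 𝔪` ideals of `K[x₁, …, xₙ]` with `𝔪` maximal and
`K[x]_𝔪 / P K[x]_𝔪` regular (`V(P)` is regular at the closed point `𝔪`), and `W ∋ 𝔪` an open
subset of `𝔸ⁿ_K`. Then there are `G ∉ 𝔪`, a non-empty `s ⊆ {1, …, n}` and a `K`-algebra
endomorphism `Φ` of `K[x]` such that `D(G) ⊆ W`, the composite `D(G) ↪ 𝔸ⁿ --Spec Φ--> 𝔸ⁿ` is
étale, and on `D(G)` the ideal sheaf of `P` is the inverse image of the ideal sheaf of the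
coordinate subspace `L = V(xᵢ : i ∈ s)`: `P̃|_{D(G)} = ((Spec Φ)^* 𝓘_L)|_{D(G)}`. (Adapted
coordinates `uᵢ = Φ(xᵢ)`, flat and unramified at `𝔪`, hence étale near `𝔪` by EGA IV₄ 17.6.1.)
[cite: BierstoneGrigorievMilmanWlodarczyk2011, §3.5 and proof of Thm. 4.0.6] [cite: Grothendieck1967, Thm. 17.6.1] -/
theorem exists_etale_chart_of_isRegularLocalRing_quotient [CharZero K]
    (P : Ideal (MvPolynomial (Fin n) K)) (hP : P ≠ ⊥) (𝔪 : Ideal (MvPolynomial (Fin n) K))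
    [h𝔪 : 𝔪.IsMaximal] (hPm : P ≤ 𝔪)
    (hreg : IsRegularLocalRing (Localization.AtPrime 𝔪 ⧸
      P.map (algebraMap (MvPolynomial (Fin n) K) (Localization.AtPrime 𝔪))))
    (W : (Spec (CommRingCat.of (MvPolynomial (Fin n) K))).Opens)
    (hW : (⟨𝔪, h𝔪.isPrime⟩ : PrimeSpectrum (MvPolynomial (Fin n) K)) ∈ W) :
    ∃ (G : MvPolynomial (Fin n) K) (s : Set (Fin n))
      (Φ : MvPolynomial (Fin n) K →ₐ[K] MvPolynomial (Fin n) K),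
      G ∉ 𝔪 ∧ s.Nonempty ∧
      Set.range (Spec.map (CommRingCat.ofHom
        (algebraMap (MvPolynomial (Fin n) K) (Localization.Away G)))) ⊆ W ∧
      Etale (Spec.map (CommRingCat.ofHom
          (algebraMap (MvPolynomial (Fin n) K) (Localization.Away G))) ≫
        Spec.map (CommRingCat.ofHom (Φ : MvPolynomial (Fin n) K →+* MvPolynomial (Fin n) K))) ∧
      (affineBlowup.idealSheaf P).comap (Spec.map (CommRingCat.ofHom
          (algebraMap (MvPolynomial (Fin n) K) (Localization.Away G)))) =
        ((affineBlowup.idealSheaf (Ideal.span (X '' s : Set (MvPolynomial (Fin n) K)))).comap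
            (Spec.map (CommRingCat.ofHom
              (Φ : MvPolynomial (Fin n) K →+* MvPolynomial (Fin n) K)))).comap
          (Spec.map (CommRingCat.ofHom
            (algebraMap (MvPolynomial (Fin n) K) (Localization.Away G)))) := by
  classical
  set R := MvPolynomial (Fin n) K with hR
  haveI : 𝔪.IsPrime := h𝔪.isPrime
  set B := Localization.AtPrime 𝔪 with hB
  -- adapted coordinates
  obtain ⟨u, s, hu𝔪, huP, hspan, hPloc⟩ :=
    exists_coordinates_of_isRegularLocalRing_quotient 𝔪 P hPm hreg
  set Φ : R →ₐ[K] R := aeval u with hΦdef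
  have hΦX : ∀ i, Φ (X i) = u i := fun i => aeval_X u i
  -- `s ≠ ∅` since `P ≠ 0`
  have hs : s.Nonempty := by
    by_contra hs0
    rw [Set.not_nonempty_iff_eq_empty] at hs0
    rw [hs0, Set.image_empty, Ideal.span_empty] at hPloc
    have hinj : Function.Injective (algebraMap R B) :=
      IsLocalization.injective B 𝔪.primeCompl_le_nonZeroDivisors
    exact hP ((Ideal.map_eq_bot_iff_of_injective hinj).mp hPloc)
  -- the local homomorphism at `𝔪` is flat and unramified
  have hgen : maximalIdeal B ≤ Ideal.span (Set.range fun i => algebraMap R B (Φ (X i))) := by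
    rw [← hspan]
    apply Ideal.span_mono
    rintro _ ⟨i, rfl⟩
    refine ⟨i, ?_⟩
    show algebraMap R B (Φ (X i)) = algebraMap R B (u i)
    rw [hΦX]
  obtain ⟨hfl, hur⟩ := localRingHom_flat_and_formallyUnramified (ι := Fin n) (ι' := Fin n)
    le_rfl Φ 𝔪 (fun i => (hΦX i).symm ▸ hu𝔪 i) hgen
  -- transfer to the stalk map of `φ = Spec Φ` at `z = 𝔪` and get an étale neighbourhood
  set φ : Spec (CommRingCat.of R) ⟶ Spec (CommRingCat.of R) :=
    Spec.map (CommRingCat.ofHom (Φ : R →+* R)) with hφ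
  set z : Spec (CommRingCat.of R) := ⟨𝔪, h𝔪.isPrime⟩ with hz
  haveI : LocallyOfFinitePresentation φ := locallyOfFinitePresentation_specMap_algHom Φ
  have hfl' : (φ.stalkMap z).hom.Flat :=
    (RingHom.Flat.respectsIso.arrow_mk_iso_iff
      (Scheme.arrowStalkMapSpecIso (CommRingCat.ofHom (Φ : R →+* R)) z)).mpr hfl
  have hur' : (φ.stalkMap z).hom.FormallyUnramified :=
    (RingHom.FormallyUnramified.respectsIso.arrow_mk_iso_iff
      (Scheme.arrowStalkMapSpecIso (CommRingCat.ofHom (Φ : R →+* R)) z)).mpr hur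
  obtain ⟨O, hzO, hO⟩ := exists_etale_ι_comp_of_flat_of_formallyUnramified_stalkMap φ z hfl' hur'
  -- spread `P K[x]_𝔪 = (uᵢ : i ∈ s) K[x]_𝔪` over a basic open
  set Q : Ideal R := Ideal.span (u '' s) with hQ
  have hQP : Q ≤ P := by
    rw [hQ, Ideal.span_le]
    rintro _ ⟨i, hi, rfl⟩
    exact huP i hi
  have hPQ : P.map (algebraMap R B) ≤ Q.map (algebraMap R B) := by
    rw [hPloc, hQ, Ideal.map_span, ← Set.image_comp]
    rfl
  obtain ⟨g, hg𝔪, hg⟩ := exists_not_mem_forall_map_eq 𝔪 hQP hPQ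
  -- a basic open `D(G) ∋ z` inside `O ∩ W ∩ D(g)`
  have hopen : IsOpen (((O ⊓ W : (Spec (CommRingCat.of R)).Opens) : Set (Spec (CommRingCat.of R))) ∩
      (PrimeSpectrum.basicOpen g : Set (PrimeSpectrum R))) :=
    (O ⊓ W).2.inter (PrimeSpectrum.basicOpen g).2
  have hzmem : z ∈ ((O ⊓ W : (Spec (CommRingCat.of R)).Opens) : Set (Spec (CommRingCat.of R))) ∩
      (PrimeSpectrum.basicOpen g : Set (PrimeSpectrum R)) := ⟨⟨hzO, hW⟩, hg𝔪⟩
  obtain ⟨_, ⟨G', rfl⟩, hzG', hG'sub⟩ :=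
    (PrimeSpectrum.isTopologicalBasis_basic_opens (R := R)).exists_subset_of_mem_open hzmem hopen
  have hG'𝔪 : G' ∉ 𝔪 := hzG'
  set G : R := G' * g with hGdef
  have hG𝔪 : G ∉ 𝔪 := fun h => (h𝔪.isPrime.mem_or_mem h).elim hG'𝔪 hg𝔪
  have hGsub : (PrimeSpectrum.basicOpen G : Set (PrimeSpectrum R)) ⊆ PrimeSpectrum.basicOpen G' := by
    rw [hGdef, PrimeSpectrum.basicOpen_mul]
    exact Set.inter_subset_left
  set ιG := Spec.map (CommRingCat.ofHom (algebraMap R (Localization.Away G))) with hιG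
  have hrange : Set.range ιG = (PrimeSpectrum.basicOpen G : Set (PrimeSpectrum R)) :=
    range_specMap_algebraMap_away G
  have hgunit : IsUnit (algebraMap R (Localization.Away G) g) :=
    isUnit_of_dvd_unit (map_dvd _ (dvd_mul_left g G')) (IsLocalization.Away.algebraMap_isUnit G)
  refine ⟨G, s, Φ, hG𝔪, hs, ?_, ?_, ?_⟩
  · -- `D(G) ⊆ W`
    rw [hrange]
    intro x hx
    exact (hG'sub (hGsub hx)).1.2
  · -- `D(G) ↪ 𝔸ⁿ → 𝔸ⁿ` is étale: `D(G) ↪ O` is an open immersion and `O → 𝔸ⁿ` is étale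
    have hsubO : Set.range ιG ⊆ Set.range O.ι := by
      rw [hrange, Scheme.Opens.range_ι]
      intro x hx
      exact (hG'sub (hGsub hx)).1.1
    let l := IsOpenImmersion.lift O.ι ιG hsubO
    have hl : l ≫ O.ι = ιG := IsOpenImmersion.lift_fac _ _ _
    haveI : IsOpenImmersion (l ≫ O.ι) := by
      rw [hl]
      infer_instance
    haveI : IsOpenImmersion l := IsOpenImmersion.of_comp l O.ι
    haveI := hO
    show Etale (ιG ≫ φ)
    rw [← hl, Category.assoc]
    infer_instance
  · -- the ideals on `D(G)`
    rw [← Scheme.IdealSheafData.comap_comp, ← Spec.map_comp, ← CommRingCat.ofHom_comp,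
      affineBlowup.comap_idealSheaf_specMap, affineBlowup.comap_idealSheaf_specMap,
      affineBlowup.idealSheaf_inj, ← Ideal.map_map]
    have hΦspan : (Ideal.span (X '' s : Set R)).map (Φ : R →+* R) = Q := by
      rw [hQ, Ideal.map_span, ← Set.image_comp]
      congr 1
      refine Set.image_congr fun i _ => ?_
      exact hΦX i
    rw [hΦspan]
    exact hg (Localization.Away G) hgunit

end Chart

end Literature.AlgebraicGeometry.Resolution

end
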